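import Literature.AlgebraicTopology.Homotopy.RelativeHomotopyGroups
import HarnessLib

/-!
# Exactness of the homotopy sequence of a pair

Topic `Literature/AlgebraicTopology/Homotopy` (Hatcher, *Algebraic Topology* (2002), §4.1,
Thm. 4.3, p. 344; Miller, *Lectures on Algebraic Topology* (2020), Lecture 47, p. 155 and
Cor. 47.6). For a subspace `A ⊆ X` and a base point `a ∈ A`, the sequence of pointed sets
```
  ⋯ → πₙ(A, a) —i_*→ πₙ(X, a) —j_*→ πₙ(X, A, a) —∂→ πₙ₋₁(A, a) —i_*→ πₙ₋₁(X, a) → ⋯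
```
(`homotopyGroupIncl`, `RelHomotopyGroup.ofAbsolute`, `RelHomotopyGroup.boundary` of
`RelativeHomotopyGroups.lean`, where the three composites are shown to be trivial) is **exact**
(Hatcher Thm. 4.3: "This sequence is exact"; Miller Cor. 47.6). This file PROVES the three
exactness statements, as statements about pointed sets (kernel = preimage of the base point):

* `RelHomotopyGroup.exists_boundary_eq` — exactness at `πₙ₋₁(A, a)`: an element killed by `i_*`
  is a boundary (a null-homotopy in `X` of a loop in `A`, read as a map of the cube one
  dimension up, *is* a relative loop with that face);
* `RelHomotopyGroup.exists_homotopyGroupIncl_eq` — exactness at `πₙ(X, a)`: a loop in `X` that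
  is trivial in `πₙ(X, A, a)` compresses into `A` (Hatcher's compression argument: restrict the
  null-homotopy `H : I × Iⁿ → X` through relative loops to the face swept out by the free face,
  and rotate — `RelGenLoop.compress`, `RelGenLoop.homotopic_compress`);
* `RelHomotopyGroup.exists_ofAbsolute_eq` — exactness at `πₙ(X, A, a)`: a relative loop whose
  face is null-homotopic in `A` is homotopic, through relative loops, to an absolute loop (glue
  the null-homotopy of the face onto the free face; Hatcher p. 344);

and the `iff` forms `boundary_eq_const_iff`-style corollaries combining them with the complex
identities. No group structure is used: for `n ≥ 1` the maps `i_*` are group homomorphisms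
(`homotopyGroupMapHom`), so "trivial kernel" upgrades to injectivity where needed
(`injective_homotopyGroupIncl_of_subsingleton`), and exactness at `πₙ(X, a)` with
`πₙ(X, A, a) = 0` gives surjectivity (`surjective_homotopyGroupIncl_of_subsingleton`): the two
facts consumed by Whitehead-type arguments (Hatcher Thm. 4.5, Cor. 4.33; Miller Cor. 65.7).

## References

* A. Hatcher, *Algebraic Topology*, CUP (2002), §4.1, Thm. 4.3 (p. 344) and the compression
  criterion (p. 343). [HatcherAT2002]
* H. Miller, *Lectures on Algebraic Topology*, World Scientific (2020/2022), Lecture 47, p. 155,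
  Cor. 47.6 (held copy PDF pp. 155–156). [Miller2020]
-/

noncomputable section

open scoped Topology Topology.Homotopy unitInterval
open ContinuousMap

namespace Literature.AlgebraicTopology.Homotopy

variable {N : Type*} [DecidableEq N] {X : Type*} [TopologicalSpace X] {i : N} {A : Set X} {a : A}

namespace RelGenLoop

/-! ### Exactness at `πₙ₋₁(A, a)`: null-homotopies in `X` of loops in `A` are relative loops -/

/-- A null-homotopy `G : I × I^{N∖i} → X` rel `∂I^{N∖i}` of (the image in `X` of) a generalized loop
`q` of `A`, read through `Cube.splitAt i : Iᴺ ≃ₜ I × I^{N∖i}`, is a relative loop of `(X, A, a)`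
whose face is `q` (Hatcher 2002, proof of Thm. 4.3, exactness at `πₙ₋₁(A)`). [cite: HatcherAT2002, Thm. 4.3] -/
def ofNullHomotopy (q : Ω^ { j // j ≠ i } A a)
    (G : ((⟨Subtype.val, continuous_subtype_val⟩ : C(A, X)).comp (q : C(I^{ j // j ≠ i }, A))).HomotopyRel
      (GenLoop.const : Ω^ { j // j ≠ i } X (a : X)).1 (Cube.boundary { j // j ≠ i })) :
    RelGenLoop i A a :=
  ⟨G.toContinuousMap.comp ⟨Cube.splitAt i, (Cube.splitAt i).continuous⟩,
    fun y hy => by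
      show G (y i, fun j => y (j : N)) ∈ A
      rw [hy, G.apply_zero]
      exact (q _).2,
    fun y hy => by
      show G (y i, fun j => y (j : N)) = a
      rcases hy with hy | ⟨j, hji, hj⟩
      · rw [hy, G.apply_one]; rfl
      · have hb : (fun j : { j // j ≠ i } => y (j : N)) ∈ Cube.boundary { j // j ≠ i } := ⟨⟨j, hji⟩, hj⟩
        have h1 := G.prop' (y i) _ hb
        exact (h1.trans (congrArg Subtype.val (q.2 _ hb)) : _)⟩

/-- `ofNullHomotopy q G` is `G ∘ splitAt i` pointwise. [folklore] -/
@[simp]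
theorem ofNullHomotopy_apply (q : Ω^ { j // j ≠ i } A a) (G) (y : I^N) :
    ofNullHomotopy q G y = G (y i, fun j => y (j : N)) := rfl

/-- The face of `ofNullHomotopy q G` is `q` itself. [folklore] -/
theorem face_ofNullHomotopy (q : Ω^ { j // j ≠ i } A a) (G) : face (ofNullHomotopy q G) = q := by
  ext y'
  show G (Cube.insertAt i (0, y') i, fun j => Cube.insertAt i (0, y') (j : N)) = q y'
  simp only [insertAt_apply_self, insertAt_apply_ne]
  exact G.apply_zero y'

/-! ### Exactness at `πₙ(X, a)`: compression -/

section Compress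

variable (p : Ω^ N X (a : X))
  (H : (p : C(I^N, X)).HomotopyWith (const i A a : C(I^N, X)) (· ∈ RelGenLoop i A a))

/-- **Compression.** For a generalized loop `p` of `X` at `a` and a null-homotopy `H` of `p`
*through relative loops of `(X, A, a)`*, the map swept out by the free face,
`y ↦ H (y i, y[i ↦ 0])`, is a generalized loop of `A` at `a` (Hatcher 2002, proof of Thm. 4.3,
exactness at `πₙ(X, x₀)`, via the compression criterion p. 343). [cite: HatcherAT2002, Thm. 4.3] -/
def compress : Ω^ N A a :=
  ⟨⟨fun y => ⟨H (y i, Cube.insertAt i (0, fun j => y (j : N))),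
      (H.prop' (y i)).1 _ (insertAt_apply_self i 0 _)⟩,
    (H.continuous.comp ((continuous_apply i).prodMk ((Cube.insertAt i).continuous.comp
      (continuous_const.prodMk (continuous_pi fun j => continuous_apply (j : N)))))).subtype_mk _⟩,
    fun y hy => by
      apply Subtype.ext
      show H (y i, Cube.insertAt i (0, fun j => y (j : N))) = a
      rcases (mem_boundary_iff i y).1 hy with hy | hy | ⟨j, hji, hj⟩
      · rw [hy, H.apply_zero]
        exact p.2 _ (Cube.insertAt_boundary i (Or.inl (Or.inl rfl)))
      · rw [hy, H.apply_one]; rfl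
      · exact (H.prop' (y i)).2 _
          (insertAt_mem_jBoundary_of_mem_boundary i 0 ⟨⟨j, hji⟩, hj⟩)⟩

/-- Pointwise formula for `compress`. [folklore] -/
@[simp]
theorem coe_compress_apply (y : I^N) :
    ((compress p H y : A) : X) = H (y i, Cube.insertAt i (0, fun j => y (j : N))) := rfl

/-- First coordinate of the corner path `(1, 0) → (1, 1) → (0, 1)` along the boundary of the
square: `min 1 (2 - 2s)`. [folklore] -/
def cornerPath₁ (s : I) : I := Set.projIcc 0 1 zero_le_one (2 - 2 * s)

/-- Second coordinate of the corner path `(1, 0) → (1, 1) → (0, 1)`: `min 1 (2s)`. [folklore] -/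
def cornerPath₂ (s : I) : I := Set.projIcc 0 1 zero_le_one (2 * s)

/-- `cornerPath₁` is continuous. [folklore] -/
theorem continuous_cornerPath₁ : Continuous cornerPath₁ := continuous_projIcc.comp (by fun_prop)

/-- `cornerPath₂` is continuous. [folklore] -/
theorem continuous_cornerPath₂ : Continuous cornerPath₂ := continuous_projIcc.comp (by fun_prop)

/-- The corner path starts at `(1, 0)`: first coordinate. [folklore] -/
@[simp] theorem cornerPath₁_zero : cornerPath₁ 0 = 1 :=
  (Set.projIcc_of_right_le _ (by norm_num)).trans rfl

/-- The corner path starts at `(1, 0)`: second coordinate. [folklore] -/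
@[simp] theorem cornerPath₂_zero : cornerPath₂ 0 = 0 :=
  (Set.projIcc_of_le_left _ (by norm_num)).trans rfl

/-- The corner path ends at `(0, 1)`: first coordinate. [folklore] -/
@[simp] theorem cornerPath₁_one : cornerPath₁ 1 = 0 :=
  (Set.projIcc_of_le_left _ (by norm_num)).trans rfl

/-- The corner path ends at `(0, 1)`: second coordinate. [folklore] -/
@[simp] theorem cornerPath₂_one : cornerPath₂ 1 = 1 :=
  (Set.projIcc_of_right_le _ (by norm_num)).trans rfl

/-- The corner path runs along the two far sides of the square. [folklore] -/
theorem cornerPath₁_eq_one_or (s : I) : cornerPath₁ s = 1 ∨ cornerPath₂ s = 1 := by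
  by_cases hs : (s : ℝ) ≤ 1 / 2
  · exact Or.inl ((Set.projIcc_of_right_le _ (by linarith)).trans rfl)
  · exact Or.inr ((Set.projIcc_of_right_le _ (by linarith)).trans rfl)

/-- **The compression homotopy**: `p` is homotopic rel `∂Iᴺ` to (the image in `X` of) its
compression — rotate the segment `[corner, (y i, 0)]` of the `(y i, t)`-square of `H` onto the
segment `[corner, (0, y i)]` through segments ending on the far sides, where `H ≡ a`
(Hatcher 2002, proof of Thm. 4.3). [cite: HatcherAT2002, Thm. 4.3] -/
theorem homotopic_compress :
    GenLoop.Homotopic p (genLoopMap ⟨Subtype.val, continuous_subtype_val⟩ a (compress p H)) := by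
  have hcont : Continuous fun sy : I × (I^N) =>
      H (sy.2 i * cornerPath₂ sy.1, Cube.insertAt i (sy.2 i * cornerPath₁ sy.1, fun j => sy.2 (j : N))) := by
    refine H.continuous.comp (Continuous.prodMk ?_ ((Cube.insertAt i).continuous.comp
      (Continuous.prodMk ?_ (continuous_pi fun j => (continuous_apply (j : N)).comp continuous_snd))))
    · -- product in `I`: coordinatewise real multiplication (no `ContinuousMul I` in Mathlib)
      exact continuous_induced_rng.2 ((continuous_subtype_val.comp ((continuous_apply i).comp
        continuous_snd)).mul (continuous_subtype_val.comp (continuous_cornerPath₂.comp continuous_fst)))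
    · exact continuous_induced_rng.2 ((continuous_subtype_val.comp ((continuous_apply i).comp
        continuous_snd)).mul (continuous_subtype_val.comp (continuous_cornerPath₁.comp continuous_fst)))
  refine ⟨{ toFun := fun sy =>
              H (sy.2 i * cornerPath₂ sy.1, Cube.insertAt i (sy.2 i * cornerPath₁ sy.1, fun j => sy.2 (j : N)))
            continuous_toFun := hcont
            map_zero_left := fun y => ?_
            map_one_left := fun y => ?_
            prop' := fun s y hy => ?_ }⟩
  · show H (y i * cornerPath₂ 0, Cube.insertAt i (y i * cornerPath₁ 0, fun j => y (j : N))) = p y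
    rw [cornerPath₂_zero, cornerPath₁_zero, mul_zero, mul_one, insertAt_apply_restrict, H.apply_zero]
    rfl
  · show H (y i * cornerPath₂ 1, Cube.insertAt i (y i * cornerPath₁ 1, fun j => y (j : N))) = _
    rw [cornerPath₂_one, cornerPath₁_one, mul_zero, mul_one]
    rfl
  · show H (y i * cornerPath₂ s, Cube.insertAt i (y i * cornerPath₁ s, fun j => y (j : N))) = p y
    rw [GenLoop.boundary p y hy]
    rcases (mem_boundary_iff i y).1 hy with hy | hy | ⟨j, hji, hj⟩
    · rw [hy, zero_mul, zero_mul, H.apply_zero]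
      exact p.2 _ (Cube.insertAt_boundary i (Or.inl (Or.inl rfl)))
    · rw [hy, one_mul, one_mul]
      rcases cornerPath₁_eq_one_or s with hs | hs
      · rw [hs]
        exact (H.prop' _).2 _ (insertAt_one_mem_jBoundary i _)
      · rw [hs, H.apply_one]; rfl
    · exact (H.prop' _).2 _ (insertAt_mem_jBoundary_of_mem_boundary i _ ⟨⟨j, hji⟩, hj⟩)

end Compress

/-! ### Exactness at `πₙ(X, A, a)`: gluing a null-homotopy of the face onto the free face -/

section Extend

variable (r : RelGenLoop i A a)
  (F : (face r : C(I^{ j // j ≠ i }, A)).HomotopyRel (GenLoop.const : Ω^ { j // j ≠ i } A a).1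
    (Cube.boundary { j // j ≠ i }))

omit [DecidableEq N] in
variable (i) in
/-- Time parameter of the glued collar: at stage `s`, the strip `y i ≤ s / 2` of the cube carries
the null-homotopy `F` of the face at times `s - 2 (y i)` (clamped to `I`). [folklore] -/
def glueTime (sy : I × (I^N)) : I := Set.projIcc 0 1 zero_le_one ((sy.1 : ℝ) - 2 * (sy.2 i : ℝ))

omit [DecidableEq N] in
variable (i) in
/-- Rescaled `i`-th coordinate of the glued map: at stage `s`, the rest `s / 2 ≤ y i ≤ 1` of the
cube is stretched back onto `0 ≤ y i ≤ 1` (clamped to `I`). [folklore] -/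
def glueCoord (sy : I × (I^N)) : I :=
  Set.projIcc 0 1 zero_le_one (((sy.2 i : ℝ) - sy.1 / 2) / (1 - sy.1 / 2))

omit [DecidableEq N] in
variable (i) in
/-- `glueTime` is continuous. [folklore] -/
theorem continuous_glueTime : Continuous (glueTime i : I × (I^N) → I) :=
  continuous_projIcc.comp (by fun_prop)

omit [DecidableEq N] in
variable (i) in
/-- `glueCoord` is continuous (the denominator `1 - s/2 ≥ 1/2` never vanishes). [folklore] -/
theorem continuous_glueCoord : Continuous (glueCoord i : I × (I^N) → I) := by
  refine continuous_projIcc.comp (Continuous.div (by fun_prop) (by fun_prop) fun sy => ?_)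
  have := sy.1.2.2
  intro h
  have : (sy.1 : ℝ) = 2 := by linarith
  linarith

/-- **The gluing homotopy** (Hatcher 2002, proof of Thm. 4.3, exactness at `πₙ(X, A, x₀)`): at
stage `s`, the strip `y i ≤ s/2` carries the null-homotopy `F` of the face (backwards from the
seam), the rest carries `r` rescaled; at `s = 0` this is `r`, at `s = 1` the free face goes to the
base point. [cite: HatcherAT2002, Thm. 4.3] -/
def glue (sy : I × (I^N)) : X :=
  if (sy.2 i : ℝ) ≤ sy.1 / 2 then (F (glueTime i sy, fun j => sy.2 (j : N)) : X)
  else r (Cube.insertAt i (glueCoord i sy, fun j => sy.2 (j : N)))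

/-- On the strip, `glue` is the null-homotopy of the face. [folklore] -/
theorem glue_of_le {sy : I × (I^N)} (h : (sy.2 i : ℝ) ≤ sy.1 / 2) :
    glue r F sy = (F (glueTime i sy, fun j => sy.2 (j : N)) : X) := if_pos h

/-- Off the strip, `glue` is `r` rescaled. [folklore] -/
theorem glue_of_not_le {sy : I × (I^N)} (h : ¬ (sy.2 i : ℝ) ≤ sy.1 / 2) :
    glue r F sy = r (Cube.insertAt i (glueCoord i sy, fun j => sy.2 (j : N))) := if_neg h

/-- The two pieces of `glue` agree on the seam `y i = s / 2` (both are the face of `r`). [folklore] -/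
theorem glue_seam {sy : I × (I^N)} (h : (sy.2 i : ℝ) = sy.1 / 2) :
    (F (glueTime i sy, fun j => sy.2 (j : N)) : X) = r (Cube.insertAt i (glueCoord i sy, fun j => sy.2 (j : N))) := by
  have h1 : glueTime i sy = 0 := by
    refine (congrArg _ (show (sy.1 : ℝ) - 2 * (sy.2 i : ℝ) = 0 by rw [h]; ring)).trans ?_
    exact (Set.projIcc_left _).trans rfl
  have h2 : glueCoord i sy = 0 := by
    refine (congrArg _ (show ((sy.2 i : ℝ) - sy.1 / 2) / (1 - sy.1 / 2) = 0 by rw [h]; simp)).trans ?_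
    exact (Set.projIcc_left _).trans rfl
  rw [h1, h2]
  exact congrArg Subtype.val (F.apply_zero _)

/-- `glue` is continuous (pasting along the seam). [folklore] -/
theorem continuous_glue : Continuous (glue r F) := by
  refine Continuous.if_le ?_ ?_ (by fun_prop) (by fun_prop) fun sy h => glue_seam r F h
  · exact continuous_subtype_val.comp (F.continuous.comp ((continuous_glueTime i).prodMk
      (continuous_pi fun j => (continuous_apply (j : N)).comp continuous_snd)))
  · exact r.1.continuous.comp ((Cube.insertAt i).continuous.comp ((continuous_glueCoord i).prodMk
      (continuous_pi fun j => (continuous_apply (j : N)).comp continuous_snd)))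

/-- On a wall (`y j ∈ {0, 1}` for some `j ≠ i`), `glue` is the base point. [folklore] -/
theorem glue_wall (s : I) {y : I^N} {j : N} (hji : j ≠ i) (hj : y j = 0 ∨ y j = 1) :
    glue r F (s, y) = a := by
  have hb : (fun j : { j // j ≠ i } => y (j : N)) ∈ Cube.boundary { j // j ≠ i } := ⟨⟨j, hji⟩, hj⟩
  have hJ := insertAt_mem_jBoundary_of_mem_boundary i (0 : I) hb
  by_cases h : (y i : ℝ) ≤ s / 2
  · rw [glue_of_le r F h]
    have h1 := F.prop' (glueTime i (s, y)) _ hb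
    refine (congrArg Subtype.val h1).trans ?_
    exact apply_of_mem_jBoundary r hJ
  · rw [glue_of_not_le r F h]
    exact apply_of_mem_jBoundary r (insertAt_mem_jBoundary_of_mem_boundary i _ hb)

/-- On the face `y i = 1`, `glue` is the base point. [folklore] -/
theorem glue_top (s : I) {y : I^N} (hy : y i = 1) : glue r F (s, y) = a := by
  have h : ¬ ((y i : ℝ) ≤ s / 2) := by
    rw [hy, Set.Icc.coe_one]; have := s.2.2; intro h'; linarith
  rw [glue_of_not_le r F h]
  have h2 : glueCoord i (s, y) = 1 := by
    refine (congrArg _ (show ((y i : ℝ) - s / 2) / (1 - s / 2) = 1 by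
      rw [hy, Set.Icc.coe_one]; exact div_self (by have := s.2.2; intro h'; linarith))).trans ?_
    exact (Set.projIcc_right _).trans rfl
  rw [h2]
  exact apply_of_mem_jBoundary r (insertAt_one_mem_jBoundary i _)

/-- Every stage of `glue` is a relative loop of `(X, A, a)`. [folklore] -/
theorem glue_mem (s : I) : (⟨fun y => glue r F (s, y), (continuous_glue r F).comp (by fun_prop)⟩ :
    C(I^N, X)) ∈ RelGenLoop i A a := by
  refine ⟨fun y hy => ?_, ?_⟩
  · have h : (y i : ℝ) ≤ s / 2 := by rw [hy, Set.Icc.coe_zero]; have := s.2.1; linarith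
    show glue r F (s, y) ∈ A
    rw [glue_of_le r F h]
    exact (F _).2
  · rintro y (hy | ⟨j, hji, hj⟩)
    · exact glue_top r F s hy
    · exact glue_wall r F s hji hj

/-- At stage `0`, `glue` is `r`. [folklore] -/
theorem glue_zero (y : I^N) : glue r F (0, y) = r y := by
  by_cases h : ((y i : ℝ)) ≤ (0 : I) / 2
  · have hy : y i = 0 := le_antisymm (by simpa using h) (y i).2.1 |> fun h' => Subtype.ext (by simpa using h')
    rw [glue_of_le r F h]
    have h1 : glueTime i (0, y) = 0 := by
      refine (congrArg _ (show ((0 : I) : ℝ) - 2 * (y i : ℝ) = 0 by rw [hy]; simp)).trans ?_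
      exact (Set.projIcc_left _).trans rfl
    rw [h1]
    refine (congrArg Subtype.val (F.apply_zero _)).trans ?_
    show r (Cube.insertAt i (0, fun j => y (j : N))) = r y
    rw [← hy, insertAt_apply_restrict]
  · rw [glue_of_not_le r F h]
    have h2 : glueCoord i (0, y) = y i := by
      refine (congrArg _ (show ((y i : ℝ) - (0 : I) / 2) / (1 - (0 : I) / 2) = y i by simp)).trans ?_
      exact Set.projIcc_val _ _
    rw [h2, insertAt_apply_restrict]

/-- **The extended loop**: stage `1` of `glue`, a generalized loop of `X` at `a` (the free face
now goes to the base point). [cite: HatcherAT2002, Thm. 4.3] -/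
def extend : Ω^ N X (a : X) :=
  ⟨⟨fun y => glue r F (1, y), (continuous_glue r F).comp (by fun_prop)⟩, fun y hy => by
    rcases (mem_boundary_iff i y).1 hy with hy | hy | ⟨j, hji, hj⟩
    · have h : (y i : ℝ) ≤ (1 : I) / 2 := by rw [hy, Set.Icc.coe_zero, Set.Icc.coe_one]; norm_num
      show glue r F (1, y) = a
      rw [glue_of_le r F h]
      have h1 : glueTime i (1, y) = 1 := by
        refine (congrArg _ (show ((1 : I) : ℝ) - 2 * (y i : ℝ) = 1 by rw [hy]; simp)).trans ?_
        exact (Set.projIcc_right _).trans rfl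
      rw [h1]
      exact congrArg Subtype.val (F.apply_one _)
    · exact glue_top r F 1 hy
    · exact glue_wall r F 1 hji hj⟩

/-- `r` is homotopic through relative loops to the (absolute) extended loop. [folklore] -/
theorem homotopic_extend : Homotopic r (ofGenLoop i (extend r F)) :=
  ⟨{ toFun := glue r F
     continuous_toFun := continuous_glue r F
     map_zero_left := glue_zero r F
     map_one_left := fun _ => rfl
     prop' := glue_mem r F }⟩

end Extend

end RelGenLoop

/-! ### The three exactness statements (Hatcher Thm. 4.3) -/

namespace RelHomotopyGroup

/-- **Exactness at `πₙ₋₁(A, a)`** of the homotopy sequence of the pair (Hatcher 2002, Thm. 4.3;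
Miller 2020, Cor. 47.6): an element of `π_{N∖i}(A, a)` whose image under `i_*` in `π_{N∖i}(X, a)`
is trivial is the boundary `∂ c` of some `c ∈ π_N(X, A, a)`. [cite: HatcherAT2002, Thm. 4.3]
[cite: Miller2020, Cor. 47.6] -/
theorem exists_boundary_eq (b : HomotopyGroup { j // j ≠ i } A a)
    (hb : homotopyGroupIncl A a b = ⟦GenLoop.const⟧) :
    ∃ c : RelHomotopyGroup i X A a, boundary c = b := by
  induction b using Quotient.inductionOn with
  | h q =>
    obtain ⟨G⟩ : GenLoop.Homotopic (genLoopMap ⟨Subtype.val, continuous_subtype_val⟩ a q) GenLoop.const :=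
      Quotient.exact hb
    exact ⟨⟦RelGenLoop.ofNullHomotopy q G⟧, by rw [boundary_mk, RelGenLoop.face_ofNullHomotopy]⟩

/-- Exactness at `πₙ₋₁(A, a)`, `iff` form: `b` is in the image of `∂` iff `i_* b` is trivial.
[cite: HatcherAT2002, Thm. 4.3] -/
theorem mem_range_boundary_iff (b : HomotopyGroup { j // j ≠ i } A a) :
    b ∈ Set.range (boundary : RelHomotopyGroup i X A a → _) ↔ homotopyGroupIncl A a b = ⟦GenLoop.const⟧ :=
  ⟨by rintro ⟨c, rfl⟩; exact homotopyGroupIncl_boundary c, fun hb => exists_boundary_eq b hb⟩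

/-- **Exactness at `πₙ(X, a)`** of the homotopy sequence of the pair (Hatcher 2002, Thm. 4.3;
Miller 2020, Cor. 47.6): an element of `π_N(X, a)` whose image under `j_*` in `π_N(X, A, a)` is
trivial is `i_* c` for some `c ∈ π_N(A, a)` (compression). [cite: HatcherAT2002, Thm. 4.3]
[cite: Miller2020, Cor. 47.6] -/
theorem exists_homotopyGroupIncl_eq (b : HomotopyGroup N X (a : X))
    (hb : (ofAbsolute i b : RelHomotopyGroup i X A a) = default) :
    ∃ c : HomotopyGroup N A a, homotopyGroupIncl A a c = b := by
  induction b using Quotient.inductionOn with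
  | h p =>
    obtain ⟨H⟩ : RelGenLoop.Homotopic (RelGenLoop.ofGenLoop i p) (RelGenLoop.const i A a) :=
      Quotient.exact hb
    exact ⟨⟦RelGenLoop.compress p H⟧, Quotient.sound (RelGenLoop.homotopic_compress p H).symm⟩

/-- Exactness at `πₙ(X, a)`, `iff` form: `b` is in the image of `i_*` iff `j_* b` is trivial.
[cite: HatcherAT2002, Thm. 4.3] -/
theorem mem_range_homotopyGroupIncl_iff (b : HomotopyGroup N X (a : X)) :
    b ∈ Set.range (homotopyGroupIncl (N := N) A a) ↔ (ofAbsolute i b : RelHomotopyGroup i X A a) = default :=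
  ⟨by rintro ⟨c, rfl⟩; exact ofAbsolute_homotopyGroupIncl c, fun hb => exists_homotopyGroupIncl_eq b hb⟩

/-- **Exactness at `πₙ(X, A, a)`** of the homotopy sequence of the pair (Hatcher 2002, Thm. 4.3;
Miller 2020, Cor. 47.6): an element of `π_N(X, A, a)` with trivial boundary in `π_{N∖i}(A, a)` is
`j_* b` for some `b ∈ π_N(X, a)`. [cite: HatcherAT2002, Thm. 4.3] [cite: Miller2020, Cor. 47.6] -/
theorem exists_ofAbsolute_eq (c : RelHomotopyGroup i X A a)
    (hc : boundary c = (⟦GenLoop.const⟧ : HomotopyGroup { j // j ≠ i } A a)) :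
    ∃ b : HomotopyGroup N X (a : X), ofAbsolute i b = c := by
  induction c using Quotient.inductionOn with
  | h r =>
    obtain ⟨F⟩ : GenLoop.Homotopic (RelGenLoop.face r) GenLoop.const := Quotient.exact hc
    exact ⟨⟦RelGenLoop.extend r F⟧, Quotient.sound (RelGenLoop.homotopic_extend r F).symm⟩

/-- Exactness at `πₙ(X, A, a)`, `iff` form: `c` is in the image of `j_*` iff `∂ c` is trivial.
[cite: HatcherAT2002, Thm. 4.3] -/
theorem mem_range_ofAbsolute_iff (c : RelHomotopyGroup i X A a) :
    c ∈ Set.range (ofAbsolute i : HomotopyGroup N X (a : X) → _) ↔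
      boundary c = (⟦GenLoop.const⟧ : HomotopyGroup { j // j ≠ i } A a) :=
  ⟨by rintro ⟨b, rfl⟩; exact boundary_ofAbsolute b, fun hc => exists_ofAbsolute_eq c hc⟩

/-! ### Consequences for `i_*` when the relative group vanishes -/

/-- If `π_N(X, A, a)` is trivial then `i_* : π_N(A, a) → π_N(X, a)` is surjective (exactness at
`π_N(X, a)`; Hatcher 2002, Thm. 4.3). [cite: HatcherAT2002, Thm. 4.3] -/
theorem surjective_homotopyGroupIncl_of_subsingleton (i : N) [Subsingleton (RelHomotopyGroup i X A a)] :
    Function.Surjective (homotopyGroupIncl (N := N) A a) := fun b =>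
  exists_homotopyGroupIncl_eq b (Subsingleton.elim (ofAbsolute i b) default)

/-- If `π_N(X, A, a)` is trivial then `i_* : π_{N∖i}(A, a) → π_{N∖i}(X, a)` is injective, for
`|N| ≥ 2` so that these are groups and `i_*` is a homomorphism with trivial kernel (exactness at
`π_{N∖i}(A, a)`; Hatcher 2002, Thm. 4.3). [cite: HatcherAT2002, Thm. 4.3] -/
theorem injective_homotopyGroupIncl_of_subsingleton [Nonempty { j // j ≠ i }]
    [Subsingleton (RelHomotopyGroup i X A a)] :
    Function.Injective (homotopyGroupIncl (N := { j // j ≠ i }) A a) := by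
  rw [show homotopyGroupIncl (N := { j // j ≠ i }) A a =
      ⇑(homotopyGroupMapHom (N := { j // j ≠ i }) (⟨Subtype.val, continuous_subtype_val⟩ : C(A, X)) a)
    from rfl]
  refine (injective_iff_map_eq_one _).2 fun b hb => ?_
  obtain ⟨c, rfl⟩ := exists_boundary_eq (i := i) b (hb.trans HomotopyGroup.one_def)
  rw [Subsingleton.elim c default, boundary_default, ← HomotopyGroup.one_def]

end RelHomotopyGroup

end Literature.AlgebraicTopology.Homotopy

end
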